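import Literature.AnabelianGeometry.EtaleTheta.Discharge.Sec5ThetaInputOfThetaCoordinate
import Literature.AnabelianGeometry.EtaleTheta.ThetaFamilyOfThetaTwistTower
import Literature.IUT.HodgeTheaters.GenuineFKitOfBadLocalClosedPairNV
import Literature.IUT.HodgeTheaters.GenuineFKitOfBadLocalNVSlots
import HarnessLib

/-!
# The (m1) slot of the L5 merge record AT A GENUINE BAD INDEX, filled by the [EtTh]-content MODEL tempered side:
# `InitialThetaData.badTemperedSideOfThetaTower`, `MergeInputs.ofGroupDataThetaTower`, and the records of record
# (closed bad pairs, the `X̲→`-stand-in) with `Θ̲_v̲ ≠ 1` in the GENUINE [IUTchI] Ex. 3.2 bad local Frobenioid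

S. Mochizuki, *Inter-universal Teichmüller theory I*, kurims manuscript (May 2020), Example 3.2 (i)–(v) pp. 69–73 («a tempered
Frobenioid `ℱ̲_v` … over a base category `𝒟_v`», «`T_(−)` the Frobenius-trivial object … that lies over `(−)`», «the birationalization
`ℱ÷_v := ℱ̲_v^birat`», «`Θ̲_v ∈ 𝒪^×(T^÷_{Ÿ_v})`», «`𝒞_v ⊆ ℱ̲_v`», «`𝒞⊢_v (⊆ 𝒞_v ⊆ ℱ̲_v → ℱ÷_v)`», «`𝒞^Θ_v (⊆ ℱ÷_v)`»), Definition 5.2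
(i)–(iv) pp. 134–135 ([IUTchI] Ex 3.2 (i) p.70) [claim: Mochizuki2012, status: disputed] (D-0012 claim key, series status DISPUTED — a MODEL
CONSTRUCTION over abc-iut-L5-t2's frozen interfaces `BadLocalGroupDatum` / `TemperedThetaInput` / `BadTemperedSide` / `MergeInputs`
(`GenuineFKitOfBadLocal.lean`, p496697) and abc-iut-L2-t6's `ThetaInputOfThetaTower.modelΘ` (`Sec5ThetaInputOfThetaCoordinate.lean`,
p507067; v1 `model` p504264); nothing of the series is asserted; no side is taken on [IUTchIII] Cor. 3.12); S. Mochizuki, *The étale theta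
function …*, Publ. RIMS **45** (2009) [MochizukiEtTh2009], Def. 3.6 (ii)/(iv) pp. 303–304 (PDF pp. 77–78), Def. 4.1 p. 312 (PDF p. 86).

## What this file builds (cell abc-iut, seat abc-iut-L2-t7 gen 10; director-abc KEY R59M1 «m1 PRODUCER for the L5 merge»,
## abc-iut-L5-lead RULINGS #119/#123 (5) «upgrade the m1 MODEL from the formal disjoint union to an [EtTh]-content model»)

abc-iut-L5-t3's knit of record (`GenuineFKitOfBadLocalTemperedSideNV.lean`, p500005) fills the (m1) slot `D.BadTemperedSide B x hx T` of the
merge record with the FORMAL disjoint-union tempered side `TemperedThetaInput.sumModel` (`ℱ̲_v := 𝒟_v ⊕ (𝒞⊢_v ⊕ 𝒞^Θ_v)`, `Θ̲_v := 1`); every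
inhabited merge record of record (`mergeInputsStandIn` p501395, `nonempty_mergeInputs_of_isClosed` p505920-lineage) carries that slot.
abc-iut-L2-t6 built, for EVERY group datum `T` over EVERY Galois-valuation datum, the [EtTh]-content MODEL tempered side
`ThetaInputOfThetaTower.modelΘ T hq R S A₀` (`ℱ̲_v := C_{A₀} ⊕ (𝒞⊢_v ⊕ 𝒞^Θ_v)` with `C_{A₀}` the ε-free theta tower's [EtTh] Def. 3.6 (ii)
tempered Frobenioid read at the covering `A₀` and constantly re-based over `𝒟_v`, `𝒞_v := C_{A₀}^{bs-fld} ⊕ 𝒞⊢_v` with the REAL faithful hull,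
`ℱ÷_v := ℱ̲_v × B(L_Θ)`, `Θ̲_v := (𝟙, ϑ) ≠ 1`).  NO file instantiated it at a genuine bad index.  This file is exactly that knit:
* §1 **`D.badTemperedSideOfThetaTower B x hx T R S A₀ : D.BadTemperedSide B x hx T`** — the (m1) slot at the bad index `x` over ANY group datum `T`
  on the pair's OWN `Π_{X̳̲_v̲} = (B x hx).H`, at the GENUINE Galois-valuation datum `gvdAt x` (`K_v̲ = K_w`, `G_v̲ = Gal(K̄_w/K_w)`) and the GENUINE
  non-unit `q̲_v̲ = qRootAtIdx x` (p442528), with `Kt := modelΘ`; `_Kt`, `_Fv`, `_Fbirat`, `_Cv` (all rfl: the carriers ARE abc-iut-L2-t6's);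
  content `_exists_mem_Φ_not_mem_bsFld` (`Φ ⊋ Φ^{bs-fld}` at every object of `𝒟_v̲`: a PROPER [EtTh] hull) and `_isPerfect_Φ`, BY NAME at the pair's `Π`.
* §2 **`MergeInputs.ofGroupDataThetaTower D B m2 m4 hTFG A₀ : D.MergeInputs B`** (vocabulary parameters `R = S := ⊤`) and
  `MergeInputs.ofGroupDataThetaTowerModuli` ((m4) := abc-iut-L5-t2's GENUINE `realifiedGlobalSideOfModuli`, p497530) — abc-iut-L5-t3's
  `MergeInputs.ofGroupData` pattern with the (m1) slots of §1; rfl lemmas; **`exists_mergeInputs_frobeniusBadAt_theta_ne_one_of_groupData`**.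
* §3 **CONTENT AT THE GENUINE Ex. 3.2 DATUM**: for `I := ofGroupDataThetaTower …`, abc-iut-L5-t2's GENUINE bad local Frobenioid
  `D.frobeniusBadAt B I x hx` (REAL `q_v̲`, `q̲_v̲`, `𝒟⊢_v̲`, `𝒞⊢_v̲ ⥲ 𝒞^Θ_v̲` on the kit's own `Π`) has `ℱ̲_v̲ = C_{A₀} ⊕ (𝒞⊢_v̲ ⊕ 𝒞^Θ_v̲)`
  (`frobeniusBadAt_ofGroupDataThetaTower_Fv`, rfl), `𝒞_v̲ = C_{A₀}^{bs-fld} ⊕ 𝒞⊢_v̲` (`_Cv`), **`Θ̲_v̲ ≠ 1`** (`_theta_ne_one`), `𝒪^×(T^÷_Ÿ) = ⟨Θ̲_v̲⟩`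
  (`_unitsTY`), `l·ℤ = ⊥` (`_lZ`, honesty), `T_A` over `A` on the nose (`_toBase_obj_T`).
* §4 **THE RECORDS OF RECORD, UPGRADED**: `MergeInputs.thetaTowerOfClosed B hH hTFG A₀` ((m2) := abc-iut-L5-t2's `m2OfClosed` at EVERY closed
  bad-pair family) and **`D.mergeInputsThetaTowerStandIn hA CG hTFG A₀ : D.MergeInputs (fun v _ => D.badPairAtArrow hA v)`** ((m2) := `m2StandIn`;
  `mergeInputsThetaTowerStandIn_m2_m4` = SAME (m2)/(m4) as `mergeInputsStandIn`, rfl), `frobeniusBadAt_thetaTowerStandIn_theta_ne_one`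
  (the genuine `ℱ`-kit ★ p496697 applies to THIS record verbatim — abc-iut-L5-t2 `nonempty_fkit_standIn` BY NAME), and the closers at the tower coverings
  `A₀ := Y_n` (abc-iut-L2-d2's `ThetaTwistTowerTempered.YV n`): **`exists_mergeInputs_standIn_frobeniusBadAt_theta_ne_one`**,
  `exists_mergeInputs_of_isClosed_frobeniusBadAt_theta_ne_one`.

LABEL (travels with every use): «[m1 MODEL v2 AT A GENUINE BAD INDEX: genuine `K_v̲`, `G_v̲`, `q̲_v̲`, the pair's own `Π_{X̳̲_v̲}`; the
`ℱ̲_v̲`/`𝒞_v̲`-summands = the ε-free theta tower's [EtTh] Def. 3.6 (ii) category + base-field-theoretic hull read at ONE covering `A₀`, CONSTANT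
over `𝒟_v̲` (abc-iut-L2-t6 `constRebase`); `ℱ÷_v̲` = birationalization STAND-IN `ℱ̲_v̲ × B(L_Θ)` (NOT [FrdI] Prop. 4.4); `Θ̲_v̲` = the generator of
the tower's Θ̈-Kummer COORDINATE group `L_Θ ≅ Ẑ`, NOT print's Kummer class of `Θ̈` on `Ÿ_v̲`; `l·ℤ`, constants TRIVIAL; `𝒞⊢_v̲`, `𝒞^Θ_v̲` formal
summands — it is NOT the tempered Frobenioid of the Tate curve `X̲̲_v̲` (abc-iut-L2-lead R1169 «MODEL ONLY» / abc-iut-L5-lead RULINGS #123 (5):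
IUTchI:Ex3.2(i) = FOUNDATIONS-BOUNDARY HOLD, GAP row G-L5-EX32I-1 — UNCHANGED by this file) and carries NO [IUTchI] Ex. 3.2 (i) token]».
BINDER CENSUS: §1 {`B`, `x`, `hx`, `T`, `R`, `S`, `A₀`}; §2/§3 {`B`, `m2`, `m4`, `hTFG` = FACT F-0240 `GeomTFG` as the displayed field it already is,
`A₀`}; §4 {`B`, `hH`} / {`hA`, `CG`, `hTFG`} (abc-iut-L5-t2's, verbatim) ∪ {`A₀` or `n`} — nothing else (the kit term ★ p496697 applies to
these records verbatim, abc-iut-L5-t2 `nonempty_fkit_standIn` BY NAME); FACT unnamed 0; LAW 0; 0 instance · 0 notation · no `Prop` fact · no sorry · nothing restated (every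
upstream decl consumed BY NAME).  HONEST FRAMING: a MODEL inhabitant witnesses OUR binders only; «genuine» qualifies the INDEX data (`K_v̲`,
`q̲_v̲`, `Π`), not the tempered side; typed ≠ inhabited ≠ discharged; nothing here asserts abc proved or refuted.
-/

noncomputable section

namespace Literature.IUT.HodgeTheaters

open CategoryTheory Opposite Literature.AnabelianGeometry.SemiGraphs Literature.AlgebraicGeometry.Frobenioids
  Literature.AlgebraicGeometry.Frobenioids.PadicFrd Literature.AnabelianGeometry.EtaleTheta

variable {F K Fbar : Type} [Field F] [NumberField F] [Field K] [NumberField K] [Algebra F K]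
  [Field Fbar] [Algebra F Fbar] [Algebra K Fbar] {E : WeierstrassCurve F}
  [E.IsElliptic] {l : ℕ} {Pb : BadPlacePredicates K} (D : InitialThetaData F K Fbar E l Pb)

namespace InitialThetaData

/-! ### §1. The (m1) slot at a genuine bad index over ANY group datum, filled by `ThetaInputOfThetaTower.modelΘ` -/

section Slot

variable (B : ∀ v, v ∈ D.indexCopyBad → D.BadPairAt v) (x : D.IndexCopy) (hx : x ∈ D.indexCopyBad)
  (T : BadLocalGroupDatum (D.GalAt x (D.not_mem_arc_of_mem_bad hx)) ↥(B x hx).H)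
  (R S : ((CosetCat ↥(B x hx).H)ᵒᵖ ⥤ CommMonCat.{0}) → Prop)
  (A₀ : ConnectedPart (BTemp TateTowerKummerTwistRShear.Compat₃'))

/-- **THE (m1) SLOT AT A GENUINE BAD INDEX WITH [EtTh] CONTENT** — `D.BadTemperedSide B x hx T` over ANY group datum `T` on the pair's own
`Π_{X̳̲_v̲}`, at the GENUINE `gvdAt x` and the GENUINE non-unit `q̲_v̲ = qRootAtIdx x`: carriers `ℱ̲_v̲ := C_{A₀} ⊕ (𝒞⊢_v̲ ⊕ 𝒞^Θ_v̲)`,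
`ℱ÷_v̲ := ℱ̲_v̲ × B(L_Θ)`, `𝒞_v̲ := C_{A₀}^{bs-fld} ⊕ 𝒞⊢_v̲`, input `Kt :=` abc-iut-L2-t6's `ThetaInputOfThetaTower.modelΘ` (vocabulary `R`, `S`,
covering `A₀` of the ε-free theta tower).  LABEL «[m1 MODEL v2 AT A GENUINE BAD INDEX …; NOT the tempered Frobenioid of `X̲̲_v̲`; no Ex. 3.2 (i)
token]». ([IUTchI] Ex 3.2 (i) p.70) [claim: Mochizuki2012, status: disputed] -/
def badTemperedSideOfThetaTower : D.BadTemperedSide B x hx T :=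
  haveI : Fact (D.primeAt x (D.not_mem_arc_of_mem_bad hx)).Prime := D.fact_primeAt_prime x _
  { Fv := ThetaInputOfThetaTower.Carrier T (D.qRootAtIdx_not_isUnit x hx) R S A₀
    Fbirat := ThetaInputOfThetaTower.BiratCarrier T (D.qRootAtIdx_not_isUnit x hx) R S A₀
    Cv := ThetaInputOfThetaTower.HullCarrier (D.qRootAtIdx_not_isUnit x hx) R S A₀
    Kt := ThetaInputOfThetaTower.modelΘ T (D.qRootAtIdx_not_isUnit x hx) R S A₀ }

/-- The slot's tempered-side input IS abc-iut-L2-t6's `modelΘ` at the genuine datum (definitional).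
([IUTchI] Ex 3.2 (i) p.70) [claim: Mochizuki2012, status: disputed] -/
theorem badTemperedSideOfThetaTower_Kt :
    (D.badTemperedSideOfThetaTower B x hx T R S A₀).Kt =
      @ThetaInputOfThetaTower.modelΘ _ (D.fact_primeAt_prime x (D.not_mem_arc_of_mem_bad hx)) (D.gvdAt x _) _ _ _ T _
        (D.qRootAtIdx_not_isUnit x hx) R S A₀ := rfl

/-- The slot's `ℱ̲_v̲` IS `C_{A₀} ⊕ (𝒞⊢_v̲ ⊕ 𝒞^Θ_v̲)` — an [EtTh] Def. 3.6 (ii) tempered-Frobenioid category as first summand (abc-iut-L2-t6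
`ThetaInputOfThetaTower.Carrier`; definitional). ([IUTchI] Ex 3.2 (i) p.70) [claim: Mochizuki2012, status: disputed] -/
theorem badTemperedSideOfThetaTower_Fv [Fact (D.primeAt x (D.not_mem_arc_of_mem_bad hx)).Prime] :
    (D.badTemperedSideOfThetaTower B x hx T R S A₀).Fv =
      ThetaInputOfThetaTower.Carrier T (D.qRootAtIdx_not_isUnit x hx) R S A₀ := rfl

/-- The slot's `ℱ÷_v̲` IS the birationalization STAND-IN `ℱ̲_v̲ × B(L_Θ)` (abc-iut-L2-t6 `BiratCarrier`; definitional).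
([IUTchI] Ex 3.2 (ii) p.70) [claim: Mochizuki2012, status: disputed] -/
theorem badTemperedSideOfThetaTower_Fbirat [Fact (D.primeAt x (D.not_mem_arc_of_mem_bad hx)).Prime] :
    (D.badTemperedSideOfThetaTower B x hx T R S A₀).Fbirat =
      ThetaInputOfThetaTower.BiratCarrier T (D.qRootAtIdx_not_isUnit x hx) R S A₀ := rfl

/-- The slot's `𝒞_v̲` IS `C_{A₀}^{bs-fld} ⊕ 𝒞⊢_v̲` — the REAL base-field-theoretic hull category as first summand (abc-iut-L2-t6 `HullCarrier`;
definitional). ([IUTchI] Ex 3.2 (iii) p.71) [claim: Mochizuki2012, status: disputed] -/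
theorem badTemperedSideOfThetaTower_Cv [Fact (D.primeAt x (D.not_mem_arc_of_mem_bad hx)).Prime] :
    (D.badTemperedSideOfThetaTower B x hx T R S A₀).Cv =
      ThetaInputOfThetaTower.HullCarrier (D.qRootAtIdx_not_isUnit x hx) R S A₀ := rfl

/-- **CONTENT: at every object `A` of `𝒟_v̲ = CosetCat Π_{X̳̲_v̲}` the divisor monoid `Φ(A)` of the slot's `ℱ̲_v̲`-summand `C_{A₀}` STRICTLY contains its
base-field-theoretic part `Φ^{bs-fld}(A)`** (the class of the zero divisor of `Θ̈` on the theta tower; abc-iut-L2-t6 `model_exists_mem_Φ_not_mem_bsFld`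
at the pair's own `Π`) — so `𝒞_v̲ ⊊ ℱ̲_v̲` on the [EtTh] summand is a genuine proper hull, unlike the slot of record (`𝒞_v := 𝒞⊢_v`).
[cite: MochizukiEtTh2009, Def 3.6 p.77] -/
theorem badTemperedSideOfThetaTower_exists_mem_Φ_not_mem_bsFld (A : T.Dv) :
    ∃ y ∈ (ThetaInputOfThetaTower.frd R S A₀).Φ.carrier (op A), y ∉ (ThetaInputOfThetaTower.frd R S A₀).bsFld.carrier (op A) :=
  haveI : Fact (D.primeAt x (D.not_mem_arc_of_mem_bad hx)).Prime := D.fact_primeAt_prime x _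
  ThetaInputOfThetaTower.model_exists_mem_Φ_not_mem_bsFld T R S A₀ A

/-- CONTENT: the divisor monoid of the slot's `ℱ̲_v̲`-summand is perfect at every object of `𝒟_v̲` (abc-iut-L2-t6 `model_isPerfect_Φ` at the pair's
own `Π`). [cite: MochizukiEtTh2009, Def 4.1 p.86] -/
theorem badTemperedSideOfThetaTower_isPerfect_Φ (A : T.Dv) : IsPerfect ((ThetaInputOfThetaTower.frd R S A₀).Φ.carrier (op A)) :=
  haveI : Fact (D.primeAt x (D.not_mem_arc_of_mem_bad hx)).Prime := D.fact_primeAt_prime x _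
  ThetaInputOfThetaTower.model_isPerfect_Φ T R S A₀ A

end Slot

/-! ### §2. The merge record from the group data with the [EtTh]-content (m1) slots -/

section Merge

variable (B : ∀ v, v ∈ D.indexCopyBad → D.BadPairAt v)

/-- **`MergeInputs` FROM THE GROUP DATA with the [EtTh]-content (m1) slots**: given (m2) at every bad index, any (m4) and FACT F-0240, the merge
record whose (m1) slot at each bad index is `badTemperedSideOfThetaTower` (vocabulary parameters `R = S := ⊤`, covering `A₀`) — abc-iut-L5-t3's
`MergeInputs.ofGroupData` with the formal `sumModel` REPLACED.  LABEL «[m1 MODEL v2 AT A GENUINE BAD INDEX …]».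
([IUTchI] Def 5.2 (i) p.134) [claim: Mochizuki2012, status: disputed] -/
def MergeInputs.ofGroupDataThetaTower
    (m2 : ∀ x (hx : x ∈ D.indexCopyBad), BadLocalGroupDatum (D.GalAt x (D.not_mem_arc_of_mem_bad hx)) ↥(B x hx).H)
    (m4 : RealifiedGlobalSide) (hTFG : D.geom.extF.GeomTFG) (A₀ : ConnectedPart (BTemp TateTowerKummerTwistRShear.Compat₃')) :
    D.MergeInputs B where
  m2 := m2
  m1 x hx := D.badTemperedSideOfThetaTower B x hx (m2 x hx) (fun _ => True) (fun _ => True) A₀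
  m4 := m4
  geomTFG := hTFG

/-- Its (m2) and (m4) slots are the given ones. ([IUTchI] Ex 3.2 (i) p.70) [claim: Mochizuki2012, status: disputed] -/
theorem MergeInputs.ofGroupDataThetaTower_m2_m4
    (m2 : ∀ x (hx : x ∈ D.indexCopyBad), BadLocalGroupDatum (D.GalAt x (D.not_mem_arc_of_mem_bad hx)) ↥(B x hx).H)
    (m4 : RealifiedGlobalSide) (hTFG : D.geom.extF.GeomTFG) (A₀ : ConnectedPart (BTemp TateTowerKummerTwistRShear.Compat₃')) :
    (MergeInputs.ofGroupDataThetaTower D B m2 m4 hTFG A₀).m2 = m2 ∧ (MergeInputs.ofGroupDataThetaTower D B m2 m4 hTFG A₀).m4 = m4 :=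
  ⟨rfl, rfl⟩

/-- Its (m1) slots are the [EtTh]-content slots of §1. ([IUTchI] Ex 3.2 (i) p.70) [claim: Mochizuki2012, status: disputed] -/
theorem MergeInputs.ofGroupDataThetaTower_m1
    (m2 : ∀ x (hx : x ∈ D.indexCopyBad), BadLocalGroupDatum (D.GalAt x (D.not_mem_arc_of_mem_bad hx)) ↥(B x hx).H)
    (m4 : RealifiedGlobalSide) (hTFG : D.geom.extF.GeomTFG) (A₀ : ConnectedPart (BTemp TateTowerKummerTwistRShear.Compat₃'))
    (x : D.IndexCopy) (hx : x ∈ D.indexCopyBad) :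
    (MergeInputs.ofGroupDataThetaTower D B m2 m4 hTFG A₀).m1 x hx =
      D.badTemperedSideOfThetaTower B x hx (m2 x hx) (fun _ => True) (fun _ => True) A₀ := rfl

/-- **`MergeInputs` with the [EtTh]-content (m1) slots at `𝒞⊩_mod`**: (m4) := abc-iut-L5-t2's GENUINE `realifiedGlobalSideOfModuli` (p497530) —
binders (m2), FACT F-0240 and the covering `A₀` only. ([IUTchI] Def 5.2 (iv) p.134) [claim: Mochizuki2012, status: disputed] -/
def MergeInputs.ofGroupDataThetaTowerModuli
    (m2 : ∀ x (hx : x ∈ D.indexCopyBad), BadLocalGroupDatum (D.GalAt x (D.not_mem_arc_of_mem_bad hx)) ↥(B x hx).H)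
    (hTFG : D.geom.extF.GeomTFG) (A₀ : ConnectedPart (BTemp TateTowerKummerTwistRShear.Compat₃')) : D.MergeInputs B :=
  MergeInputs.ofGroupDataThetaTower D B m2 D.realifiedGlobalSideOfModuli hTFG A₀

/-- Its (m4) slot is `𝒞⊩_mod`, its (m2) slots are the given ones. ([IUTchI] Ex 3.5 (i) p.84) [claim: Mochizuki2012, status: disputed] -/
theorem MergeInputs.ofGroupDataThetaTowerModuli_m4_m2
    (m2 : ∀ x (hx : x ∈ D.indexCopyBad), BadLocalGroupDatum (D.GalAt x (D.not_mem_arc_of_mem_bad hx)) ↥(B x hx).H)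
    (hTFG : D.geom.extF.GeomTFG) (A₀ : ConnectedPart (BTemp TateTowerKummerTwistRShear.Compat₃')) :
    (MergeInputs.ofGroupDataThetaTowerModuli D B m2 hTFG A₀).m4 = D.realifiedGlobalSideOfModuli ∧
      (MergeInputs.ofGroupDataThetaTowerModuli D B m2 hTFG A₀).m2 = m2 := ⟨rfl, rfl⟩

/-! ### §3. Content at the GENUINE [IUTchI] Ex. 3.2 datum `frobeniusBadAt` of these records -/

section Content

variable (m2 : ∀ x (hx : x ∈ D.indexCopyBad), BadLocalGroupDatum (D.GalAt x (D.not_mem_arc_of_mem_bad hx)) ↥(B x hx).H)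
  (m4 : RealifiedGlobalSide) (hTFG : D.geom.extF.GeomTFG) (A₀ : ConnectedPart (BTemp TateTowerKummerTwistRShear.Compat₃'))
  (x : D.IndexCopy) (hx : x ∈ D.indexCopyBad)

/-- **The `ℱ̲_v̲` of abc-iut-L5-t2's GENUINE bad local Frobenioid at a genuine bad index** (REAL `q_v̲`, `q̲_v̲`, `𝒟⊢_v̲`, `𝒞⊢_v̲ ⥲ 𝒞^Θ_v̲` on the kit's own
`Π`), formed with THIS merge record, IS `C_{A₀} ⊕ (𝒞⊢_v̲ ⊕ 𝒞^Θ_v̲)` (definitional). ([IUTchI] Ex 3.2 (i) p.70) [claim: Mochizuki2012, status: disputed] -/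
theorem frobeniusBadAt_ofGroupDataThetaTower_Fv [Fact (D.primeAt x (D.not_mem_arc_of_mem_bad hx)).Prime] :
    (D.frobeniusBadAt B (MergeInputs.ofGroupDataThetaTower D B m2 m4 hTFG A₀) x hx).Fv =
      ThetaInputOfThetaTower.Carrier (m2 x hx) (D.qRootAtIdx_not_isUnit x hx) (fun _ => True) (fun _ => True) A₀ := rfl

/-- Its `𝒞_v̲` IS `C_{A₀}^{bs-fld} ⊕ 𝒞⊢_v̲` (definitional). ([IUTchI] Ex 3.2 (iii) p.71) [claim: Mochizuki2012, status: disputed] -/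
theorem frobeniusBadAt_ofGroupDataThetaTower_Cv [Fact (D.primeAt x (D.not_mem_arc_of_mem_bad hx)).Prime] :
    (D.frobeniusBadAt B (MergeInputs.ofGroupDataThetaTower D B m2 m4 hTFG A₀) x hx).Cv =
      ThetaInputOfThetaTower.HullCarrier (P := ↥(B x hx).H) (D.qRootAtIdx_not_isUnit x hx) (fun _ => True) (fun _ => True) A₀ :=
  rfl

/-- **`Θ̲_v̲ ≠ 1` IN THE GENUINE Ex. 3.2 BAD LOCAL FROBENIOID AT A GENUINE BAD INDEX** formed with THIS merge record (abc-iut-L2-t6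
`modelΘ_theta_ne_one`; the record of record gives `Θ̲_v̲ = 1` there, abc-iut-L5-t3 `sumModel_theta`). ([IUTchI] Ex 3.2 (ii) p.70) [claim: Mochizuki2012, status: disputed] -/
theorem frobeniusBadAt_ofGroupDataThetaTower_theta_ne_one [Fact (D.primeAt x (D.not_mem_arc_of_mem_bad hx)).Prime] :
    (D.frobeniusBadAt B (MergeInputs.ofGroupDataThetaTower D B m2 m4 hTFG A₀) x hx).theta ≠ 1 :=
  ThetaInputOfThetaTower.modelΘ_theta_ne_one (m2 x hx) (D.qRootAtIdx_not_isUnit x hx) _ _ A₀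

/-- Its `𝒪^×(T^÷_{Ÿ_v̲})` is the cyclic group generated by `Θ̲_v̲` (abc-iut-L2-t6 `modelΘ_unitsTY`; definitional).
([IUTchI] Ex 3.2 (ii) p.70) [claim: Mochizuki2012, status: disputed] -/
theorem frobeniusBadAt_ofGroupDataThetaTower_unitsTY [Fact (D.primeAt x (D.not_mem_arc_of_mem_bad hx)).Prime] :
    (D.frobeniusBadAt B (MergeInputs.ofGroupDataThetaTower D B m2 m4 hTFG A₀) x hx).unitsTY =
      Subgroup.zpowers (D.frobeniusBadAt B (MergeInputs.ofGroupDataThetaTower D B m2 m4 hTFG A₀) x hx).theta := rfl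

/-- HONESTY: its `l·ℤ ⊆ Aut(T_{Ÿ_v̲})` is trivial (abc-iut-L2-t6 `modelΘ_lZ`; definitional). ([IUTchI] Ex 3.2 (ii) p.71) [claim: Mochizuki2012, status: disputed] -/
theorem frobeniusBadAt_ofGroupDataThetaTower_lZ [Fact (D.primeAt x (D.not_mem_arc_of_mem_bad hx)).Prime] :
    (D.frobeniusBadAt B (MergeInputs.ofGroupDataThetaTower D B m2 m4 hTFG A₀) x hx).lZ = ⊥ := rfl

/-- Its Frobenius-trivial object `T_A` lies over `A` ON THE NOSE (abc-iut-L2-t6 `modelΘ_toBase_obj_Tobj`; definitional).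
([IUTchI] Ex 3.2 (i) p.70) [claim: Mochizuki2012, status: disputed] -/
theorem frobeniusBadAt_ofGroupDataThetaTower_toBase_obj_T [Fact (D.primeAt x (D.not_mem_arc_of_mem_bad hx)).Prime]
    (A : (D.frobeniusBadAt B (MergeInputs.ofGroupDataThetaTower D B m2 m4 hTFG A₀) x hx).Dv) :
    (D.frobeniusBadAt B (MergeInputs.ofGroupDataThetaTower D B m2 m4 hTFG A₀) x hx).toBase.obj
      ((D.frobeniusBadAt B (MergeInputs.ofGroupDataThetaTower D B m2 m4 hTFG A₀) x hx).T A) = A := rfl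

end Content

/-- **(m2) everywhere + F-0240 ⇒ a merge record with the given (m2) whose GENUINE Ex. 3.2 bad local Frobenioid has `Θ̲_v̲ ≠ 1` at EVERY bad
index.** ([IUTchI] Def 5.2 (i) p.134) [claim: Mochizuki2012, status: disputed] -/
theorem exists_mergeInputs_frobeniusBadAt_theta_ne_one_of_groupData
    (m2 : ∀ x (hx : x ∈ D.indexCopyBad), BadLocalGroupDatum (D.GalAt x (D.not_mem_arc_of_mem_bad hx)) ↥(B x hx).H)
    (hTFG : D.geom.extF.GeomTFG) (A₀ : ConnectedPart (BTemp TateTowerKummerTwistRShear.Compat₃')) :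
    ∃ I : D.MergeInputs B, I.m2 = m2 ∧ ∀ x (hx : x ∈ D.indexCopyBad) [Fact (D.primeAt x (D.not_mem_arc_of_mem_bad hx)).Prime],
      (D.frobeniusBadAt B I x hx).theta ≠ 1 :=
  ⟨MergeInputs.ofGroupDataThetaTowerModuli D B m2 hTFG A₀, rfl, fun x hx _ =>
    D.frobeniusBadAt_ofGroupDataThetaTower_theta_ne_one B m2 _ hTFG A₀ x hx⟩

end Merge

/-! ### §4. The merge records of record, with the [EtTh]-content (m1) slots -/

section Closed

variable (B : ∀ v, v ∈ D.indexCopyBad → D.BadPairAt v) (hH : ∀ x (hx : x ∈ D.indexCopyBad), IsClosed ((B x hx).H : Set D.PiC))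

/-- **The merge record at EVERY CLOSED bad-pair family** with the [EtTh]-content (m1) slots: (m2) := abc-iut-L5-t2's `m2OfClosed` (genuine canonical
augmentation, `Ÿ` degenerate — its label), (m4) := `𝒞⊩_mod`, FACT F-0240. ([IUTchI] Def 5.2 (i) p.134) [claim: Mochizuki2012, status: disputed] -/
def MergeInputs.thetaTowerOfClosed (hTFG : D.geom.extF.GeomTFG) (A₀ : ConnectedPart (BTemp TateTowerKummerTwistRShear.Compat₃')) :
    D.MergeInputs B :=
  MergeInputs.ofGroupDataThetaTowerModuli D B (fun x hx => D.m2OfClosed B x hx (hH x hx)) hTFG A₀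

/-- Its (m2) slots are `m2OfClosed`. ([IUTchI] Ex 3.2 (i) p.70) [claim: Mochizuki2012, status: disputed] -/
theorem MergeInputs.thetaTowerOfClosed_m2 (hTFG : D.geom.extF.GeomTFG) (A₀ : ConnectedPart (BTemp TateTowerKummerTwistRShear.Compat₃'))
    (x : D.IndexCopy) (hx : x ∈ D.indexCopyBad) :
    (MergeInputs.thetaTowerOfClosed D B hH hTFG A₀).m2 x hx = D.m2OfClosed B x hx (hH x hx) := rfl

include hH in
/-- **At every closed bad-pair family and every covering `Y_n` of the theta tower (`A₀ := ThetaTwistTowerTempered.YV n`, abc-iut-L2-d2): a merge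
record whose genuine Ex. 3.2 bad local Frobenioid has `Θ̲_v̲ ≠ 1` at every bad index**, from FACT F-0240 only.
([IUTchI] Def 5.2 (i) p.134) [claim: Mochizuki2012, status: disputed] -/
theorem exists_mergeInputs_of_isClosed_frobeniusBadAt_theta_ne_one (hTFG : D.geom.extF.GeomTFG) (n : ℕ) :
    ∃ I : D.MergeInputs B, ∀ x (hx : x ∈ D.indexCopyBad) [Fact (D.primeAt x (D.not_mem_arc_of_mem_bad hx)).Prime],
      (D.frobeniusBadAt B I x hx).theta ≠ 1 :=
  ⟨MergeInputs.thetaTowerOfClosed D B hH hTFG (ThetaTwistTowerTempered.YV n), fun x hx _ =>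
    D.frobeniusBadAt_ofGroupDataThetaTower_theta_ne_one B _ _ hTFG _ x hx⟩

end Closed

section StandIn

variable (hA : D.geom.pe.ArrowCoveringClaims) (CG : D.geom.pe.CuspGalois) (hTFG : D.geom.extF.GeomTFG)
  (A₀ : ConnectedPart (BTemp TateTowerKummerTwistRShear.Compat₃'))

/-- **THE MERGE RECORD AT THE `X̲→`-STAND-IN, (m1) UPGRADED**: SAME (m2) as the record of record `mergeInputsStandIn` (abc-iut-L5-t2 `m2StandIn`: aug
GENUINE, `Ÿ` degenerate — LABELLED), SAME (m4) `𝒞⊩_mod`, (m1) := `badTemperedSideOfThetaTower` at the covering `A₀`.  «[MODEL datum, labelled]».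
([IUTchI] Def 5.2 (i)-(iv) pp.134-135) [claim: Mochizuki2012, status: disputed] -/
def mergeInputsThetaTowerStandIn : D.MergeInputs fun v _ => D.badPairAtArrow hA v :=
  MergeInputs.ofGroupDataThetaTowerModuli D _
    (fun x hx =>
      haveI : Fact (D.primeAt x (D.not_mem_arc_of_mem_bad hx)).Prime := D.fact_primeAt_prime x _
      D.m2StandIn hA CG hTFG x (D.not_mem_arc_of_mem_bad hx))
    hTFG A₀

/-- Its (m2) and (m4) slots ARE those of the record of record `mergeInputsStandIn` (only (m1) changed; definitional).
([IUTchI] Ex 3.2 (i) p.70) [claim: Mochizuki2012, status: disputed] -/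
theorem mergeInputsThetaTowerStandIn_m2_m4 :
    (D.mergeInputsThetaTowerStandIn hA CG hTFG A₀).m2 = (D.mergeInputsStandIn hA CG hTFG).m2 ∧
      (D.mergeInputsThetaTowerStandIn hA CG hTFG A₀).m4 = (D.mergeInputsStandIn hA CG hTFG).m4 := ⟨rfl, rfl⟩

/-- Its (m1) slot at a bad index is the [EtTh]-content slot over the stand-in group datum (definitional).
([IUTchI] Ex 3.2 (i) p.70) [claim: Mochizuki2012, status: disputed] -/
theorem mergeInputsThetaTowerStandIn_m1 (x : D.IndexCopy) (hx : x ∈ D.indexCopyBad) :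
    (D.mergeInputsThetaTowerStandIn hA CG hTFG A₀).m1 x hx =
      D.badTemperedSideOfThetaTower (fun v _ => D.badPairAtArrow hA v) x hx
        ((D.mergeInputsThetaTowerStandIn hA CG hTFG A₀).m2 x hx) (fun _ => True) (fun _ => True) A₀ := rfl

/-- **`Θ̲_v̲ ≠ 1` in the GENUINE Ex. 3.2 bad local Frobenioid of the stand-in kit at every bad index**, with THIS record.
([IUTchI] Ex 3.2 (ii) p.70) [claim: Mochizuki2012, status: disputed] -/
theorem frobeniusBadAt_thetaTowerStandIn_theta_ne_one (x : D.IndexCopy) (hx : x ∈ D.indexCopyBad)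
    [Fact (D.primeAt x (D.not_mem_arc_of_mem_bad hx)).Prime] :
    (D.frobeniusBadAt _ (D.mergeInputsThetaTowerStandIn hA CG hTFG A₀) x hx).theta ≠ 1 :=
  D.frobeniusBadAt_ofGroupDataThetaTower_theta_ne_one _ _ _ hTFG A₀ x hx

/-- **HEADLINE (R59M1 at the ONE explicit datum of record): at the `X̲→`-stand-in kit and every covering `Y_n` of the theta tower there is a merge
record with the SAME group data as `mergeInputsStandIn` whose GENUINE Ex. 3.2 bad local Frobenioid has `Θ̲_v̲ ≠ 1` at EVERY bad index** — binders
`hA`, `CG`, F-0240 only. ([IUTchI] Def 5.2 (i) p.134) [claim: Mochizuki2012, status: disputed] -/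
theorem exists_mergeInputs_standIn_frobeniusBadAt_theta_ne_one (n : ℕ) :
    ∃ I : D.MergeInputs fun v _ => D.badPairAtArrow hA v,
      I.m2 = (D.mergeInputsStandIn hA CG hTFG).m2 ∧ ∀ x (hx : x ∈ D.indexCopyBad) [Fact (D.primeAt x (D.not_mem_arc_of_mem_bad hx)).Prime],
        (D.frobeniusBadAt _ I x hx).theta ≠ 1 :=
  ⟨D.mergeInputsThetaTowerStandIn hA CG hTFG (ThetaTwistTowerTempered.YV n), rfl, fun x hx _ =>
    D.frobeniusBadAt_thetaTowerStandIn_theta_ne_one hA CG hTFG _ x hx⟩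

end StandIn

end InitialThetaData

end Literature.IUT.HodgeTheaters

end
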